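import Summits.QuantumFields.BalabanUV.T4Continuum.Support.GradedContourRefine
import Summits.QuantumFields.BalabanUV.T4Continuum.Support.GradedWellData

/-!
# T⁴ programme, spine node NE2 (U1a), sub-row Δ1 — THE GRADED WELL, supplier brick «GW-V» file B1: AMBIENT ROWS
# (integer offset vectors, the unit block of `anchor + offset`, a fibre-counting lemma, the ambient row type `Ω ⊃ RowV` and `‖Q_GW A‖²` as a sum over it)

NE2 leaf prover 07, GEN 11 (`b2b-balaban-t4-ne2-formalise-leaf-07-g11`, numerics desk of sub-row Δ1), supplier brick «GW-V» for the row
owner's GRADED WELL (R47 journal 2026-08-21 l.25022; objects `GradedSubBlocks` p244783 / `GradedWellData` p244847; offer l.25494; numerics: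
memo `t4/T4-EST-NE2-D1-COLLAR.md` v1.1 §9.1b, job j114873 — `V = Q_GWᴴQ_GW − a·n^d·Q_⊤ᴴQ_⊤ ⪰ 0` to rounding for the typed `RowV`, FALSE for
the anchor-rule rows).

 * §1 `vecN`, `vecN_add`, `site_eq_add_vecN`, `tstep_eq_vecN`, **`blockOf_anchor_add_vecN`** (`blockOf (z + v) = blockOf z + ⌊v/n⌋` for a unit
   anchor `z` and ANY natural offset `v`), `vecN_eq_tstep`; §2 `sum_le_card_mul_sum_of_fibre`; §3 `Amb` (= `Σ_i (Anc s_i × Fin d)`, the typed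
   `RowV` is `{ω : Amb // ω ∈ rowSet}`), `rowSet` / `mem_rowSet` (print's st-convention predicate, verbatim the one of `RowV`), `Xfull`
   (`w_i²·|(Q_{s_i}A)(z,μ)|²`), `QvGW_mulVec_apply`, **`nsq_QvGW_eq`** (`‖Q_GW A‖² = Σ_{ω ∈ rowSet} Xfull ω`).

HONEST FRAMING (T4-DAG p. 1).  [folklore] finite-torus combinatorics, Cauchy–Schwarz and bookkeeping on OUR model objects (U = 1, a
layer map on unit blocks, `m` fixed, finite torus); no estimate of Bałaban's is asserted, certified or disputed; NE2 (U1a) NOT proved; spine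
PROVED 0/9 unchanged; NOT [B9] (3.16)/(3.23)–(3.27)/(3.42) as printed; NOT infinite volume / mass gap / Clay.  HONEST DEPENDENCY: continuum
YM on T⁴ ⇐ BetaPertH ∧ nine spine estimates (0/9 proved); BetaPertH ⇐ (D1) ∧ (D4) ∧ CAP+tail; G-an2-4 gates asym, D1 and NE2/3/4.  No `sorry`.
-/

noncomputable section

open scoped BigOperators ComplexConjugate Matrix
open Finset

/-! # «GW-V» file B1 — ambient rows -/
namespace Summit.QuantumFields.BalabanUV.T4Continuum.GradedWellUnitMass

open Literature.MathematicalPhysics.QuantumFieldTheory.Balaban1983to89.B5Prop11Plancherel (Tor fine unitVec)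
open Literature.MathematicalPhysics.QuantumFieldTheory.Balaban1983to89.B5Prop11Lower (nsq nsq_nonneg)
open Literature.MathematicalPhysics.QuantumFieldTheory.Balaban1983to89.B5Block118 (tstep tstep_zero tstep_succ)
open Literature.MathematicalPhysics.QuantumFieldTheory.Balaban1983to89.B5Blocks16 (blockOf)
open Literature.MathematicalPhysics.QuantumFieldTheory.Balaban1983to89.B5G183RateUnitTower (lev lev_neZero)
open Summit.QuantumFields.BalabanUV.T4Continuum
open Summit.QuantumFields.BalabanUV.T4Continuum.ScalarPlantingDefect (val_blockOf)
open Summit.QuantumFields.BalabanUV.T4Continuum.GradedSubBlocks (Anchor Anc InSub site meanS avgS avgS_mulVec s_pos site_add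
  val_site anchor_add_tstep shiftAnc)
open Literature.MathematicalPhysics.QuantumFieldTheory.Balaban1983to89.B5Composition116 (tstep_add)
open Summit.QuantumFields.BalabanUV.T4Continuum.GradedContourRefine (subAnc subAnc_val mulOff mulOff_val norm_sq_avgS_le
  anchor_of_dvd)
open Summit.QuantumFields.BalabanUV.T4Continuum.GradedWellData (sGW sGW_dvd wGW wGW_sq wGW_nonneg TorK RowV QvGW lev_eq_pow)

variable {d : ℕ}

/-! ## §1 Integer offset vectors on a torus and the unit block of `anchor + offset` -/

section Vec

variable (P : Fin d → ℕ) [hP : ∀ ν, NeZero (P ν)]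

/-- the torus vector with natural coordinates `v`. [folklore] -/
def vecN (v : Fin d → ℕ) : Tor P := fun ν => ((v ν : ℕ) : ZMod (P ν))

omit hP in
/-- `vecN` is additive. [folklore] -/
theorem vecN_add (v w : Fin d → ℕ) : vecN P v + vecN P w = vecN P (fun ν => v ν + w ν) := by
  funext ν
  simp [vecN, Nat.cast_add]

omit hP in
/-- `site z j = z + vecN j`. [folklore] -/
theorem site_eq_add_vecN (s : ℕ) (z : Tor P) (j : Fin d → Fin s) : site P s z j = z + vecN P (fun ν => (j ν : ℕ)) := by
  funext ν
  simp [site, vecN]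

omit hP in
/-- `c·e_μ = vecN (c·δ_μ)`. [folklore] -/
theorem tstep_eq_vecN (μ : Fin d) (c : ℕ) : tstep P μ c = vecN P (fun ν => if ν = μ then c else 0) := by
  funext ν
  by_cases h : ν = μ
  · subst h; simp [tstep, vecN]
  · simp [tstep, vecN, h]

end Vec

section Blocks

variable (n : ℕ) [NeZero n] (M : Fin d → ℕ) [hM : ∀ μ, NeZero (M μ)]

/-- **THE UNIT BLOCK OF `anchor + offset`**: for a unit anchor `z` (`n ∣ z_ν`) and ANY natural offset vector `v`,
`blockOf (z + v) = blockOf z + ⌊v/n⌋` coordinatewise (mod `M`). [folklore] -/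
theorem blockOf_anchor_add_vecN {z : Tor (fine n M)} (hz : Anchor (fine n M) n z) (v : Fin d → ℕ) :
    blockOf n M (z + vecN (fine n M) v) = blockOf n M z + vecN M (fun ν => v ν / n) := by
  have hn : 0 < n := Nat.pos_of_ne_zero (NeZero.ne n)
  funext ν
  apply ZMod.val_injective
  rw [val_blockOf]
  simp only [Pi.add_apply, vecN]
  rw [ZMod.val_add, ZMod.val_add, ZMod.val_natCast, ZMod.val_natCast, val_blockOf, Nat.add_mod_mod, Nat.add_mod_mod]
  obtain ⟨b, hb⟩ := hz ν
  rw [hb]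
  show (n * b + v ν) % (n * M ν) / n = (n * b / n + v ν / n) % M ν
  rw [Nat.mod_mul_right_div_self, Nat.mul_add_div hn, Nat.mul_div_cancel_left _ hn]

omit hM in
/-- a vector whose coordinates off `μ` vanish is a step: `vecN (e·δ_μ) = e·e_μ`. [folklore] -/
theorem vecN_eq_tstep (μ : Fin d) (w : Fin d → ℕ) (hw : ∀ ν, ν ≠ μ → w ν = 0) :
    vecN M w = tstep M μ (w μ) := by
  rw [tstep_eq_vecN]
  congr 1
  funext ν
  by_cases h : ν = μ
  · subst h; simp
  · simp [h, hw ν h]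

end Blocks

/-! ## §2 A fibre-counting lemma -/

/-- summing a nonnegative function along a map with fibres of size `≤ C` into a set `T`. [folklore] -/
theorem sum_le_card_mul_sum_of_fibre {ι κ : Type*} [DecidableEq κ] (S : Finset ι) (T : Finset κ) (g : ι → κ)
    (hg : ∀ i ∈ S, g i ∈ T) (X : κ → ℝ) (hX : ∀ p ∈ T, 0 ≤ X p) (C : ℕ)
    (hC : ∀ p ∈ T, (S.filter (fun i => g i = p)).card ≤ C) :
    ∑ i ∈ S, X (g i) ≤ (C : ℝ) * ∑ p ∈ T, X p := by
  rw [← Finset.sum_fiberwise_of_maps_to hg, Finset.mul_sum]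
  refine Finset.sum_le_sum fun p hp => ?_
  have e : ∑ i ∈ S with g i = p, X (g i) = ((S.filter (fun i => g i = p)).card : ℝ) * X p := by
    rw [Finset.sum_congr rfl (fun i hi => by rw [(Finset.mem_filter.mp hi).2]), Finset.sum_const, nsmul_eq_mul]
  rw [e]
  exact mul_le_mul_of_nonneg_right (by exact_mod_cast hC p hp) (hX p hp)

/-! ## §3 The graded well: rows, weights, the ambient row type -/

section GW

variable (L : ℕ) [NeZero L] (M : Fin d → ℕ) [hM : ∀ μ, NeZero (M μ)] (k m : ℕ) (layer : Tor M → ℕ)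

/-- the AMBIENT row type `Ω = Σ_i (scale-s_i anchors × directions)` (the typed `RowV` is `{ω : Ω // IsRow ω}`). [folklore] -/
abbrev Amb : Type := (i : Fin (m + 1)) × (Anc (fine (lev L k) M) (sGW L k i) × Fin d)

/-- the set of TYPED rows inside the ambient type (print's st-convention, = the predicate of `RowV`):
`min (layer of the anchor's block) (layer of the endpoint block) = i`. [folklore] -/
def rowSet : Finset (Amb L M k m) :=
  Finset.univ.filter fun ω =>
    min (layer (blockOf (lev L k) M ω.2.1.1))
      (layer (blockOf (lev L k) M (shiftAnc (fine (lev L k) M) (sGW L k ω.1) (sGW_dvd L M k ω.1) ω.2.2 ω.2.1).1)) = ω.1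

/-- membership in `rowSet`. [folklore] -/
theorem mem_rowSet (ω : Amb L M k m) :
    ω ∈ rowSet L M k m layer ↔
      min (layer (blockOf (lev L k) M ω.2.1.1))
        (layer (blockOf (lev L k) M (shiftAnc (fine (lev L k) M) (sGW L k ω.1) (sGW_dvd L M k ω.1) ω.2.2 ω.2.1).1)) = ω.1 := by
  simp [rowSet]

/-- the FULL graded quantity of an ambient row: `w_i²·|(Q_{s_i}A)(z,μ)|²` (for typed rows = `|(Q_GW A)_p|²`). [folklore] -/
def Xfull (A : TorK L M k × Fin d → ℂ) (ω : Amb L M k m) : ℝ :=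
  wGW L k d ω.1 ^ 2 * ‖(avgS (fine (lev L k) M) (sGW L k ω.1) *ᵥ A) ω.2‖ ^ 2

/-- `0 ≤ Xfull`. [folklore] -/
theorem Xfull_nonneg (A : TorK L M k × Fin d → ℂ) (ω : Amb L M k m) : 0 ≤ Xfull L M k m A ω :=
  mul_nonneg (sq_nonneg _) (sq_nonneg _)

/-- the entries of `Q_GW A`: `(Q_GW A)_p = w_i·(Q_{s_i}A)(z,μ)`. [folklore] -/
theorem QvGW_mulVec_apply (A : TorK L M k × Fin d → ℂ) (p : RowV L M k m layer) :
    (QvGW L M k m layer *ᵥ A) p = ((wGW L k d p.1.1 : ℝ) : ℂ) * (avgS (fine (lev L k) M) (sGW L k p.1.1) *ᵥ A) p.1.2 := by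
  simp only [Matrix.mulVec, dotProduct, QvGW, Finset.mul_sum, mul_assoc]

/-- **`‖Q_GW A‖² = Σ_{rows} w_i²|(Q_{s_i}A)(z,μ)|²`** as a sum over `rowSet`. [folklore] -/
theorem nsq_QvGW_eq (A : TorK L M k × Fin d → ℂ) :
    nsq (QvGW L M k m layer *ᵥ A) = ∑ ω ∈ rowSet L M k m layer, Xfull L M k m A ω := by
  unfold nsq
  rw [Finset.sum_subtype (rowSet L M k m layer) (fun ω => mem_rowSet L M k m layer ω) (Xfull L M k m A)]
  refine Finset.sum_congr rfl fun p _ => ?_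
  rw [QvGW_mulVec_apply, norm_mul, mul_pow, Complex.norm_real, Real.norm_eq_abs, sq_abs]
  rfl

end GW

end Summit.QuantumFields.BalabanUV.T4Continuum.GradedWellUnitMass

end
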